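import Mathlib
import Summits.Ventures.PercRepro2.Defs
import Summits.Ventures.PercRepro2.Independence
import Summits.Ventures.PercRepro2.Harris
import Summits.Ventures.PercRepro2.Graph
import Summits.Ventures.PercRepro2.Exploration
import Summits.Ventures.PercRepro2.Events
import Summits.Ventures.PercRepro2.FourFunctions
import Summits.Ventures.PercRepro2.Induced
import Summits.Ventures.PercRepro2.Frontier
import Summits.Ventures.PercRepro2.ObsIndependence
import Summits.Ventures.PercRepro2.BHK
import Summits.Ventures.PercRepro2.BHKEvents
import Summits.Ventures.PercRepro2.VdBKahn
import Summits.Ventures.PercRepro2.BHKAvoid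
import Summits.Ventures.PercRepro2.OrderPreservation
import Summits.Ventures.PercRepro2.OrderPreservationDual
import Summits.Ventures.PercRepro2.OrderPreservationQuant
import Summits.Ventures.PercRepro2.Merge
import Summits.Ventures.PercRepro2.R2PrimeThreeReduction
import Summits.Ventures.PercRepro2.YBridge
import Summits.Ventures.PercRepro2.EdgeBHK
import Summits.Ventures.PercRepro2.Yu1Functionals
import Summits.Ventures.PercRepro2.HF2
import Summits.Ventures.PercRepro2.Yu2
import Summits.Ventures.PercRepro2.Yu1
import Summits.Ventures.PercRepro2.N0

/-!
# (Y) is a theorem: `split ≤ φ · (M₂ + Δ_T)` (blind cell PercRepro2, p1)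

Assembly of the three pieces of the (Y) skeleton (`proofs/LEAD-PROOFSHAPES.md` §8.9 ADDENDUM 10 (10)):
* (Yu1) `T_{l→h} · P(PD) ≤ P(PD, o ∈ C₁) · W` — `yu1_cleared` (typer-1, light-first exploration);
* (Yu2) `T_{h→l} · P(PD) ≤ P(PD, o ∈ C₂) · W` — `yu2_of_hf2` (heavy-first exploration + HF2),
  restated here in the `YBridge` vocabulary as `yu2_cleared`;
* (N0) `P(o ∈ Ũ | PD) ≤ φ` — `n0` (typer-1, edge-cluster BHK in the merged graph);
with `W = M₂ + Δ_T ≥ 0` (`Δ_T ≥ 0` is R10, `hf2_deltaT_nonneg`). Summing the two pieces over the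
disjoint events `{o ∈ C₁}`, `{o ∈ C₂}` under `PD` gives `split · P(PD) ≤ P(PD, o ∈ Ũ) · W`, then (N0).
`y_theorem` : `Y p ends o a₁ a₂ a₃ b` under the labelling `P(a₁ ↔ b) ≤ P(a₂ ↔ b)` (row 2′Y), and
`sc2_theorem` : SC″ at `a₃` under the order `P(a₃ ↔ b) ≤ P(a₁ ↔ b)` via `YBridge.SC2_of_Y`.
-/

namespace Summit.Ventures.PercRepro2

open UnionCluster

section YAssembly

variable {V : Type*} {E : Type*} [Fintype E] [DecidableEq E] [Fintype V] [DecidableEq V]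
  {R : Type*} [Field R] [LinearOrder R] [IsStrictOrderedRing R]

omit [Fintype E] [DecidableEq E] [Fintype V] [DecidableEq V] in
/-- `PD` in the raw spelling of `HF2.lean` / `Yu2.lean` (`h = a₂`, `l = a₁`, `t = a₃`). -/
lemma PDEvent_eq_raw (ends : E → Sym2 V) (a₁ a₂ a₃ : V) :
    PDEvent ends a₁ a₂ a₃ =
      (connEvent ends a₂ a₁)ᶜ ∩ (connEvent ends a₂ a₃)ᶜ ∩ (connEvent ends a₃ a₁)ᶜ := by
  ext ω
  simp only [PDEvent, Dtilde, inU, Set.mem_inter_iff, Set.mem_compl_iff, Set.mem_union,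
    mem_connEvent, not_or]
  exact ⟨fun ⟨h12, h31, h32⟩ => ⟨⟨fun h => h12 (conn_symm h), fun h => h32 (conn_symm h)⟩, h31⟩,
    fun ⟨⟨h21, h23⟩, h31⟩ => ⟨fun h => h21 (conn_symm h), h31, fun h => h23 (conn_symm h)⟩⟩

/-- **(Yu2) in the `YBridge` vocabulary**: `T_{h→l} · P(PD) ≤ P(PD, o ∈ C₂) · (M₂ + Δ_T)` under the
labelling `P(a₁ ↔ b) ≤ P(a₂ ↔ b)`. -/
theorem yu2_cleared (p : E → R) (hp : IsProbVec p) (ends : E → Sym2 V) {o a₁ a₂ a₃ b : V}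
    (hord : prob p (connEvent ends a₁ b) ≤ prob p (connEvent ends a₂ b)) :
    prob p (PDEvent ends a₁ a₂ a₃ ∩ connEvent ends a₂ o ∩ connEvent ends a₁ b) *
        prob p (PDEvent ends a₁ a₂ a₃) ≤
      prob p (PDEvent ends a₁ a₂ a₃ ∩ connEvent ends a₂ o) *
        (massM2 p ends a₁ a₂ a₃ b + deltaT p ends a₁ a₂ a₃ b) := by
  have key := yu2_of_hf2 p hp ends o a₁ a₂ a₃ b hord
  unfold massM2 deltaT TEvent
  rw [PDEvent_eq_raw]
  exact key

omit [Fintype E] [DecidableEq E] [Fintype V] [DecidableEq V] in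
/-- Under `PD` the events `{o ∈ C₁}` and `{o ∈ C₂}` are disjoint. -/
lemma PD_disjoint_o (ends : E → Sym2 V) (o a₁ a₂ a₃ : V) :
    Disjoint (PDEvent ends a₁ a₂ a₃ ∩ connEvent ends a₁ o)
      (PDEvent ends a₁ a₂ a₃ ∩ connEvent ends a₂ o) := by
  rw [Set.disjoint_left]
  rintro ω ⟨⟨h12, _⟩, h1o⟩ ⟨_, h2o⟩
  exact h12 (conn_trans h1o (conn_symm h2o))

omit [Fintype E] [DecidableEq E] [Fintype V] [DecidableEq V] in
/-- `PD ∩ {o ∈ Ũ} = (PD ∩ {o ∈ C₁}) ∪ (PD ∩ {o ∈ C₂})`. -/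
lemma PD_inU_eq_union (ends : E → Sym2 V) (o a₁ a₂ a₃ : V) :
    inU ends a₁ a₂ o ∩ PDEvent ends a₁ a₂ a₃ =
      (PDEvent ends a₁ a₂ a₃ ∩ connEvent ends a₁ o) ∪
        (PDEvent ends a₁ a₂ a₃ ∩ connEvent ends a₂ o) := by
  ext ω
  simp only [inU, Set.mem_inter_iff, Set.mem_union, mem_connEvent]
  constructor
  · rintro ⟨h, hPD⟩
    rcases h with h | h
    · exact Or.inl ⟨hPD, conn_symm h⟩
    · exact Or.inr ⟨hPD, conn_symm h⟩
  · rintro (⟨hPD, h⟩ | ⟨hPD, h⟩)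
    · exact ⟨Or.inl (conn_symm h), hPD⟩
    · exact ⟨Or.inr (conn_symm h), hPD⟩

/-- **(Y) is a theorem** (CONJECTURES row 2′Y): for the labelling `P(a₁ ↔ b) ≤ P(a₂ ↔ b)` and any
third root `a₃`, `split ≤ φ · (M₂ + Δ_T)`. The side conditions `a₁ ≠ a₂`, `a₃ ≠ a₁`, `o ≠ a₁` are those
of the merged-graph step (N0). -/
theorem y_theorem (p : E → R) (hp : IsProbVec p) (ends : E → Sym2 V) {o a₁ a₂ a₃ b : V}
    (h12 : a₁ ≠ a₂) (h31 : a₃ ≠ a₁) (ho : o ≠ a₁)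
    (hord : prob p (connEvent ends a₁ b) ≤ prob p (connEvent ends a₂ b)) :
    Y p ends o a₁ a₂ a₃ b := by
  unfold Y splitMass
  have hW0 : 0 ≤ massM2 p ends a₁ a₂ a₃ b + deltaT p ends a₁ a₂ a₃ b := by
    have h1 : 0 ≤ massM2 p ends a₁ a₂ a₃ b := prob_nonneg hp _
    have h2 : 0 ≤ deltaT p ends a₁ a₂ a₃ b := by
      have := hf2_deltaT_nonneg p hp ends a₂ a₁ a₃ b hord
      unfold deltaT TEvent
      exact this
    linarith
  have h1 := yu1_cleared p hp ends (o := o) (a₃ := a₃) hord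
  have h2 := yu2_cleared p hp ends (o := o) (a₃ := a₃) hord
  have hsum : prob p (PDEvent ends a₁ a₂ a₃ ∩ connEvent ends a₁ o) +
      prob p (PDEvent ends a₁ a₂ a₃ ∩ connEvent ends a₂ o) =
      prob p (inU ends a₁ a₂ o ∩ PDEvent ends a₁ a₂ a₃) := by
    rw [PD_inU_eq_union, prob_union_of_disjoint p (PD_disjoint_o ends o a₁ a₂ a₃)]
  have hsplit : (prob p (PDEvent ends a₁ a₂ a₃ ∩ connEvent ends a₁ o ∩ connEvent ends a₂ b) +
      prob p (PDEvent ends a₁ a₂ a₃ ∩ connEvent ends a₂ o ∩ connEvent ends a₁ b)) *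
        prob p (PDEvent ends a₁ a₂ a₃) ≤
      prob p (inU ends a₁ a₂ o ∩ PDEvent ends a₁ a₂ a₃) *
        (massM2 p ends a₁ a₂ a₃ b + deltaT p ends a₁ a₂ a₃ b) := by
    rw [← hsum, add_mul, add_mul]
    linarith
  rcases (prob_nonneg hp (PDEvent ends a₁ a₂ a₃)).lt_or_eq with hPD | hPD0
  · have hn0 := n0 p hp ends h12 h31 ho hPD
    calc prob p (PDEvent ends a₁ a₂ a₃ ∩ connEvent ends a₁ o ∩ connEvent ends a₂ b) +
          prob p (PDEvent ends a₁ a₂ a₃ ∩ connEvent ends a₂ o ∩ connEvent ends a₁ b) =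
        (prob p (PDEvent ends a₁ a₂ a₃ ∩ connEvent ends a₁ o ∩ connEvent ends a₂ b) +
          prob p (PDEvent ends a₁ a₂ a₃ ∩ connEvent ends a₂ o ∩ connEvent ends a₁ b)) *
          prob p (PDEvent ends a₁ a₂ a₃) / prob p (PDEvent ends a₁ a₂ a₃) := by
          field_simp
      _ ≤ prob p (inU ends a₁ a₂ o ∩ PDEvent ends a₁ a₂ a₃) *
          (massM2 p ends a₁ a₂ a₃ b + deltaT p ends a₁ a₂ a₃ b) / prob p (PDEvent ends a₁ a₂ a₃) :=
          div_le_div_of_nonneg_right hsplit hPD.le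
      _ = prob p (inU ends a₁ a₂ o ∩ PDEvent ends a₁ a₂ a₃) / prob p (PDEvent ends a₁ a₂ a₃) *
          (massM2 p ends a₁ a₂ a₃ b + deltaT p ends a₁ a₂ a₃ b) := by ring
      _ ≤ phi p ends o a₁ a₂ a₃ * (massM2 p ends a₁ a₂ a₃ b + deltaT p ends a₁ a₂ a₃ b) :=
          mul_le_mul_of_nonneg_right hn0 hW0
  · -- `P(PD) = 0`: both split terms vanish
    have hT1 : prob p (PDEvent ends a₁ a₂ a₃ ∩ connEvent ends a₁ o ∩ connEvent ends a₂ b) = 0 :=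
      le_antisymm (hPD0 ▸ prob_mono hp (Set.inter_subset_left.trans Set.inter_subset_left))
        (prob_nonneg hp _)
    have hT2 : prob p (PDEvent ends a₁ a₂ a₃ ∩ connEvent ends a₂ o ∩ connEvent ends a₁ b) = 0 :=
      le_antisymm (hPD0 ▸ prob_mono hp (Set.inter_subset_left.trans Set.inter_subset_left))
        (prob_nonneg hp _)
    rw [hT1, hT2, add_zero]
    exact mul_nonneg (phi_nonneg hp ends o a₁ a₂ a₃) hW0

/-- **SC″ at `a₃` is a theorem** under the order `P(a₃ ↔ b) ≤ P(a₁ ↔ b) ≤ P(a₂ ↔ b)`: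
`split ≤ φ · (mb − m₃)` (`YBridge.SC2_of_Y` applied to `y_theorem`). -/
theorem sc2_theorem (p : E → R) (hp : IsProbVec p) (ends : E → Sym2 V) {o a₁ a₂ a₃ b : V}
    (h12 : a₁ ≠ a₂) (h31 : a₃ ≠ a₁) (ho : o ≠ a₁)
    (h3 : prob p (connEvent ends a₃ b) ≤ prob p (connEvent ends a₁ b))
    (hord : prob p (connEvent ends a₁ b) ≤ prob p (connEvent ends a₂ b)) :
    SC2 p ends o a₁ a₂ a₃ b :=
  SC2_of_Y hp ends (y_theorem p hp ends h12 h31 ho hord) h3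

end YAssembly

section Closures

variable (R : Type) [Field R] [LinearOrder R] [IsStrictOrderedRing R]

/-- **(Y) for every finite graph** (`YBridge.Y_all`). -/
theorem Y_all_holds : Y_all R := by
  intro V E _ _ _ _ ends p hp o a₁ a₂ a₃ b h12 h13 _ ho _ _ _ _ _ _ hord
  exact y_theorem p hp ends h12 (Ne.symm h13) ho hord

/-- **SC″ for every finite graph** (`YBridge.SC2_all`). -/
theorem SC2_all_holds : SC2_all R := SC2_all_of_Y_all R (Y_all_holds R)

end Closures

end Summit.Ventures.PercRepro2
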